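import Literature.IUT.HodgeArakelov.EtaleThetaDataOfSettingAutActionTheta
import Literature.IUT.HodgeArakelov.EtaleThetaDataOfSettingAutActionInner
import Literature.IUT.HodgeArakelov.CohomologyAutCoeffChange

/-!
# [IUTchII] Prop 1.4 / [EtTh] Cor 2.8 (iii) at the genuine data: the Π-intrinsic TOP-level action of an INNER
# automorphism of `Π^tp_X̲̲` is conjugation — so the root binder `hroot` (G-w5d169-2) holds at every inner `α` outright

S. Mochizuki, *The étale theta function …*, Publ. RIMS **45** (2009) [EtTh] (refereed), Cor. 2.8 (iii) p. 42 ("if `γ`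
arises from an inner automorphism … then `γ` preserves `η̲̈^{Θ,l·ℤ}`"), Cor. 2.19 (iii) p. 65
[cite: MochizukiEtTh2009, Cor 2.8(iii) p.42]; S. Mochizuki, *Inter-universal Teichmüller theory II* (kurims, Dec. 2020),
Prop. 1.4 p. 27, Cor. 1.12 (i) p. 56 (claim key `Mochizuki2012`, DISPUTED, D-0012) [cite: Mochizuki2012, Cor 1.12 (i) p.56].
Transport of structure in group cohomology [cite: NeukirchSchmidtWingberg2008, I §5].

abc-iut cell (block C / W6 seat abc-iut-w6-d051 gen 4; node IUTchII:Prop3.4(i), binder (P4) `hroot`, GAP row G-w5d169-2).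
PROOF-ONLY (0 def).  abc-iut-w5-d169's `EtaleThetaDataOfSettingAutActionInner` proves the LIMIT-level inner case
(`autActOfCor218i (conjCME c) = h1LimConj c`); HERE the TOP-level twin on `H1 ⊤ ≅ H¹(Π^tp_Ÿ̲̲, l·Δ_Θ)` where `hroot` lives:
* `autActH1_eq_conj_of_inner` — `autActH1 α = ContH1.conj c` for `α = conj c` (abc-iut-w4-d010's
  `ContH1Aut.autMap_eq_conj_of_inner` at the restricted ambient + abc-iut-w5-d169's `rangeAut_apply_of_inner`);
* `autActTopOfCor218i_conjCME` — `ρ^⊤_{conj c} = h1TopConjEquiv c` on `(coh C).H1 ⊤`;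
* **`rootHyp_of_inner`** — the conclusion of `hroot` holds at `α = conjCME c` with `τ = c`, `ε = 0`, for EVERY `c ∈ Π^tp_X̲̲`
  and NO fact ([EtTh] Cor. 2.8 (iii)): a non-vacuity datum for the census;
* `autActH1_trans` / `autActTopOfCor218i_trans` (TOP twin of `autActOfCor218i_trans`), `autActTopOfCor218i_congr`;
* `rootHyp_refl` / **`rootHyp_trans`** / **`rootHyp_symm`** — with `rootHyp_of_inner`: the `α` satisfying `hroot` are CLOSED
  under composition and inversion and contain all inner automorphisms (a subgroup of `Aut_top(Π^tp_X̲̲)` ⊇ Inn): (P4)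
  descends to OUTER automorphism classes and need only be supplied on generators (every supplier route — Route 1 core,
  Route 2 companion / intrinsic — may restrict to them).
Nothing of [IUTchII] asserted; no side taken on [IUTchIII] Cor. 3.12; typed ≠ proved.
-/

noncomputable section

open Topology

namespace Literature.IUT.HodgeArakelov

namespace EtaleThetaDataOfSetting

open Literature.AnabelianGeometry.EtaleTheta (ContH1)
open Literature.AnabelianGeometry.EtaleTheta CohomologySystemOfContH1
open Literature.AnabelianGeometry.SemiGraphs.Thm68Sub (conjCME conjCME_apply)

variable {p : ℕ} [Fact p.Prime] {D : Literature.AnabelianGeometry.EtaleTheta.ThetaSetting p}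
  {E : D.EtaleThetaData} {l : ℕ} (C : E.DoubleUnderline l) (hq : IsQuotientMap D.toTheta)

/-- **The top-level Π-intrinsic action of an inner automorphism is conjugation**: for `α = conj c`,
`autActH1 α = ContH1.conj c` on `H¹(Π^tp_Ÿ̲̲ ⊓ ⊤, l·Δ_Θ)` (`rangeAut (conj c) = conj φ(c)`, and an inner pair acts by
`ContH1.conj`). [cite: Mochizuki2012, Cor 1.12 (i) p.56] -/
theorem autActH1_eq_conj_of_inner [(PiYdd C).Normal] (α : (Pi C) ≃ₜ* (Pi C))
    (hker : ∀ x, x ∈ (phi C).ker ↔ α x ∈ (phi C).ker)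
    (hA : ∀ x, x ∈ (D.lDeltaTheta l).comap (phi C) ↔ α x ∈ (D.lDeltaTheta l).comap (phi C))
    (hH : ∀ x, x ∈ PiYdd C ↔ α x ∈ PiYdd C) (c : Pi C) (hαc : ∀ g, α g = c * g * c⁻¹)
    (x : ContH1 (phi C) (D.lDeltaTheta l) (PiYdd C ⊓ ⊤)) :
    autActH1 C hq α hker hA hH x = ContH1.conj (phi C) (D.lDeltaTheta l) c x := by
  apply (topRestrict C).injective
  rw [topRestrict_autActH1, ContH1Restrict.h1Equiv_conj]
  exact ContH1Aut.autMap_eq_conj_of_inner (phiR C) α (rangeAut C α hker hq) (rangeAut_phiR C α hker hq) _ _ c hαc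
    (fun a _ => rangeAut_apply_of_inner C hq α hker c hαc a) (topRestrict C x)

variable {N : ℕ+} (μ : D.CyclotomeMod l N)

/-- **`ρ^⊤_{conj c} = h1TopConjEquiv c`** on `(coh C).H1 ⊤` (the top twin of abc-iut-w5-d169's `autActOfCor218i_conjCME`).
[cite: Mochizuki2012, Cor 1.12 (i) p.56] -/
theorem autActTopOfCor218i_conjCME [(PiYdd C).Normal] (hC : D.Compat) (hS : D.Sec2Hyps) (h15 : D.Prop15iii E hC)
    (L : C.CuspLabels) (R : RigidData.{0} N l) (hR : R = C.rigidData μ hC hS h15 L) (h218i : R.Cor218_i) (c : Pi C)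
    (x : (coh C).H1 ⊤) :
    autActTopOfCor218i C hq μ hC hS h15 L R hR h218i (conjCME c) x =
      h1TopConjEquiv (phi C) (D.lDeltaTheta l) (PiYdd C) c x := by
  obtain ⟨y, rfl⟩ : ∃ y, x = (h1Top C).symm y := ⟨h1Top C x, ((h1Top C).symm_apply_apply x).symm⟩
  have e2 := h1TopConjEquiv_symm_apply (phi C) (D.lDeltaTheta l) (PiYdd C) c y
  unfold autActTopOfCor218i
  rw [autActTop_h1Top_symm]
  change _ = h1TopConjEquiv (phi C) (D.lDeltaTheta l) (PiYdd C) c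
    ((h1EquivOfFiniteIndexOpen (phi C) (D.lDeltaTheta l) (PiYdd C) ⊤ inferInstance (by simp)).symm y)
  rw [e2]
  change (h1Top C).symm _ = (h1Top C).symm _
  congr 1
  exact congrArg Additive.ofMul (autActH1_eq_conj_of_inner C hq (conjCME c) _ _ _ c (fun _ => rfl) (Additive.toMul y))

/-- **`hroot` at every INNER automorphism, unconditionally**: for `α = conj c`, `c ∈ Π^tp_X̲̲`, the conclusion of the
root binder (P4) of [IUTchII] Prop 3.4 (i) — `ρ^⊤_α η̲̈ = conj_τ η̲̈ + ε`, `l • ε = 0` — holds with `τ = c`, `ε = 0`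
([EtTh] Cor. 2.8 (iii): inner automorphisms preserve the root orbit without constant-multiple indeterminacy).
[cite: MochizukiEtTh2009, Cor 2.8(iii) p.42] -/
theorem rootHyp_of_inner [(PiYdd C).Normal] (hC : D.Compat) (hS : D.Sec2Hyps) (h15 : D.Prop15iii E hC)
    (L : C.CuspLabels) (R : RigidData.{0} N l) (hR : R = C.rigidData μ hC hS h15 L) (h218i : R.Cor218_i) (c : Pi C) :
    ∃ τ : Pi C, ∃ ε : (coh C).H1 ⊤, l • ε = 0 ∧
      autActTopOfCor218i C hq μ hC hS h15 L R hR h218i (conjCME c) (rootTop C) =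
        h1TopConjEquiv (phi C) (D.lDeltaTheta l) (PiYdd C) τ (rootTop C) + ε :=
  ⟨c, 0, smul_zero _, by rw [add_zero, autActTopOfCor218i_conjCME]⟩


/-! ### The composition law at the top level, and `hroot` as a SUBGROUP condition -/

/-- **Composition law for the top-level Π-intrinsic action**: `autActH1 (α₁ ≫ α₂) = autActH1 α₂ ∘ autActH1 α₁`
(abc-iut-w5-d169's `rangeAut_trans` + abc-iut-L6-t1's pair transport composed on representatives; the proof arguments for
the composite are arbitrary). [cite: Mochizuki2012, Cor 1.12 (i) p.56] -/
theorem autActH1_trans (α₁ α₂ : (Pi C) ≃ₜ* (Pi C))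
    (hker₁ : ∀ x, x ∈ (phi C).ker ↔ α₁ x ∈ (phi C).ker)
    (hA₁ : ∀ x, x ∈ (D.lDeltaTheta l).comap (phi C) ↔ α₁ x ∈ (D.lDeltaTheta l).comap (phi C))
    (hH₁ : ∀ x, x ∈ PiYdd C ↔ α₁ x ∈ PiYdd C)
    (hker₂ : ∀ x, x ∈ (phi C).ker ↔ α₂ x ∈ (phi C).ker)
    (hA₂ : ∀ x, x ∈ (D.lDeltaTheta l).comap (phi C) ↔ α₂ x ∈ (D.lDeltaTheta l).comap (phi C))
    (hH₂ : ∀ x, x ∈ PiYdd C ↔ α₂ x ∈ PiYdd C)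
    (hker : ∀ x, x ∈ (phi C).ker ↔ (α₁.trans α₂) x ∈ (phi C).ker)
    (hA : ∀ x, x ∈ (D.lDeltaTheta l).comap (phi C) ↔ (α₁.trans α₂) x ∈ (D.lDeltaTheta l).comap (phi C))
    (hH : ∀ x, x ∈ PiYdd C ↔ (α₁.trans α₂) x ∈ PiYdd C)
    (x : ContH1 (phi C) (D.lDeltaTheta l) (PiYdd C ⊓ ⊤)) :
    autActH1 C hq (α₁.trans α₂) hker hA hH x =
      autActH1 C hq α₂ hker₂ hA₂ hH₂ (autActH1 C hq α₁ hker₁ hA₁ hH₁ x) := by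
  apply (topRestrict C).injective
  rw [topRestrict_autActH1, topRestrict_autActH1, topRestrict_autActH1]
  have hr := rangeAut_trans C hq α₁ α₂ hker₁ hker₂ hker
  generalize topRestrict C x = y
  induction y using QuotientGroup.induction_on with
  | H f =>
    change QuotientGroup.mk _ = QuotientGroup.mk _
    congr 1
    apply Subtype.ext; funext z; apply Subtype.ext; apply Subtype.ext
    rw [ContH1Aut.coe_autCocycle_apply, ContH1Aut.coe_autCocycle_apply, ContH1Aut.coe_autCocycle_apply, hr]
    rfl

/-- **Composition law for `ρ^⊤`**: `ρ^⊤_{α₁ ≫ α₂} = ρ^⊤_{α₂} ∘ ρ^⊤_{α₁}` on `(coh C).H1 ⊤` (the TOP twin of abc-iut-w5-d169's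
`autActOfCor218i_trans`). [cite: Mochizuki2012, Cor 1.12 (i) p.56] -/
theorem autActTopOfCor218i_trans (hC : D.Compat) (hS : D.Sec2Hyps) (h15 : D.Prop15iii E hC) (L : C.CuspLabels)
    (R : RigidData.{0} N l) (hR : R = C.rigidData μ hC hS h15 L) (h218i : R.Cor218_i) (α₁ α₂ : (Pi C) ≃ₜ* (Pi C))
    (x : (coh C).H1 ⊤) :
    autActTopOfCor218i C hq μ hC hS h15 L R hR h218i (α₁.trans α₂) x =
      autActTopOfCor218i C hq μ hC hS h15 L R hR h218i α₂ (autActTopOfCor218i C hq μ hC hS h15 L R hR h218i α₁ x) := by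
  obtain ⟨y, rfl⟩ : ∃ y, x = (h1Top C).symm y := ⟨h1Top C x, ((h1Top C).symm_apply_apply x).symm⟩
  unfold autActTopOfCor218i
  rw [autActTop_h1Top_symm, autActTop_h1Top_symm, autActTop_h1Top_symm, toMul_ofMul]
  congr 2
  exact autActH1_trans C hq α₁ α₂ _ _ _ _ _ _ _ _ _ (Additive.toMul y)

/-- Congruence of `ρ^⊤` in `α` (all proof arguments are derived from `α`). [cite: Mochizuki2012, Cor 1.12 (i) p.56] -/
theorem autActTopOfCor218i_congr (hC : D.Compat) (hS : D.Sec2Hyps) (h15 : D.Prop15iii E hC) (L : C.CuspLabels)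
    (R : RigidData.{0} N l) (hR : R = C.rigidData μ hC hS h15 L) (h218i : R.Cor218_i) {α α' : (Pi C) ≃ₜ* (Pi C)}
    (h : α = α') (x : (coh C).H1 ⊤) :
    autActTopOfCor218i C hq μ hC hS h15 L R hR h218i α x = autActTopOfCor218i C hq μ hC hS h15 L R hR h218i α' x := by
  subst h; rfl

section RootHypSubgroup

/-- **`hroot` at the identity** (`τ = 1`, `ε = 0`). [cite: MochizukiEtTh2009, Cor 2.8(iii) p.42] -/
theorem rootHyp_refl [(PiYdd C).Normal] (hC : D.Compat) (hS : D.Sec2Hyps) (h15 : D.Prop15iii E hC)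
    (L : C.CuspLabels) (R : RigidData.{0} N l) (hR : R = C.rigidData μ hC hS h15 L) (h218i : R.Cor218_i) :
    ∃ τ : Pi C, ∃ ε : (coh C).H1 ⊤, l • ε = 0 ∧
      autActTopOfCor218i C hq μ hC hS h15 L R hR h218i (ContinuousMulEquiv.refl (Pi C)) (rootTop C) =
        h1TopConjEquiv (phi C) (D.lDeltaTheta l) (PiYdd C) τ (rootTop C) + ε := by
  have h1 : conjCME (1 : Pi C) = ContinuousMulEquiv.refl (Pi C) := by
    ext g; rw [conjCME_apply, one_mul, inv_one, mul_one]; rfl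
  rw [← autActTopOfCor218i_congr C hq μ hC hS h15 L R hR h218i h1]
  exact rootHyp_of_inner C hq μ hC hS h15 L R hR h218i 1

/-- **`hroot` is stable under COMPOSITION**: if `ρ^⊤_{α₁} η̲̈ = conj_{τ₁} η̲̈ + ε₁` and `ρ^⊤_{α₂} η̲̈ = conj_{τ₂} η̲̈ + ε₂` with
`l`-torsion `ε₁, ε₂`, then `ρ^⊤_{α₁ ≫ α₂} η̲̈ = conj_{α₂(τ₁)·τ₂} η̲̈ + (conj_{α₂ τ₁} ε₂ + ρ^⊤_{α₂} ε₁)` (composition law +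
equivariance `autActTopOfCor218i_h1TopConjEquiv`; additive automorphisms preserve `l`-torsion).
[cite: MochizukiEtTh2009, Cor 2.19 (iii) p.65] -/
theorem rootHyp_trans [(PiYdd C).Normal] (hC : D.Compat) (hS : D.Sec2Hyps) (h15 : D.Prop15iii E hC)
    (L : C.CuspLabels) (R : RigidData.{0} N l) (hR : R = C.rigidData μ hC hS h15 L) (h218i : R.Cor218_i)
    {α₁ α₂ : (Pi C) ≃ₜ* (Pi C)}
    (h₁ : ∃ τ : Pi C, ∃ ε : (coh C).H1 ⊤, l • ε = 0 ∧
      autActTopOfCor218i C hq μ hC hS h15 L R hR h218i α₁ (rootTop C) =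
        h1TopConjEquiv (phi C) (D.lDeltaTheta l) (PiYdd C) τ (rootTop C) + ε)
    (h₂ : ∃ τ : Pi C, ∃ ε : (coh C).H1 ⊤, l • ε = 0 ∧
      autActTopOfCor218i C hq μ hC hS h15 L R hR h218i α₂ (rootTop C) =
        h1TopConjEquiv (phi C) (D.lDeltaTheta l) (PiYdd C) τ (rootTop C) + ε) :
    ∃ τ : Pi C, ∃ ε : (coh C).H1 ⊤, l • ε = 0 ∧
      autActTopOfCor218i C hq μ hC hS h15 L R hR h218i (α₁.trans α₂) (rootTop C) =
        h1TopConjEquiv (phi C) (D.lDeltaTheta l) (PiYdd C) τ (rootTop C) + ε := by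
  obtain ⟨τ₁, ε₁, hε₁, e₁⟩ := h₁
  obtain ⟨τ₂, ε₂, hε₂, e₂⟩ := h₂
  refine ⟨α₂ τ₁ * τ₂, h1TopConjEquiv (phi C) (D.lDeltaTheta l) (PiYdd C) (α₂ τ₁) ε₂ +
    autActTopOfCor218i C hq μ hC hS h15 L R hR h218i α₂ ε₁, ?_, ?_⟩
  · rw [smul_add, ← map_nsmul, ← map_nsmul, hε₁, hε₂, map_zero, map_zero, add_zero]
  · rw [autActTopOfCor218i_trans, e₁, map_add, autActTopOfCor218i_h1TopConjEquiv, e₂, map_add,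
      h1TopConjEquiv_mul_apply, add_assoc]

/-- **`hroot` is stable under INVERSION**: from `ρ^⊤_α η̲̈ = conj_τ η̲̈ + ε` one gets
`ρ^⊤_{α⁻¹} η̲̈ = conj_{(α⁻¹ τ)⁻¹} η̲̈ − conj_{(α⁻¹ τ)⁻¹} (ρ^⊤_{α⁻¹} ε)` (apply `ρ^⊤_{α⁻¹} = (ρ^⊤_α)⁻¹`,
`autActTopOfCor218i_symm_apply`). [cite: MochizukiEtTh2009, Cor 2.19 (iii) p.65] -/
theorem rootHyp_symm [(PiYdd C).Normal] (hC : D.Compat) (hS : D.Sec2Hyps) (h15 : D.Prop15iii E hC)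
    (L : C.CuspLabels) (R : RigidData.{0} N l) (hR : R = C.rigidData μ hC hS h15 L) (h218i : R.Cor218_i)
    {α : (Pi C) ≃ₜ* (Pi C)}
    (h : ∃ τ : Pi C, ∃ ε : (coh C).H1 ⊤, l • ε = 0 ∧
      autActTopOfCor218i C hq μ hC hS h15 L R hR h218i α (rootTop C) =
        h1TopConjEquiv (phi C) (D.lDeltaTheta l) (PiYdd C) τ (rootTop C) + ε) :
    ∃ τ : Pi C, ∃ ε : (coh C).H1 ⊤, l • ε = 0 ∧
      autActTopOfCor218i C hq μ hC hS h15 L R hR h218i α.symm (rootTop C) =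
        h1TopConjEquiv (phi C) (D.lDeltaTheta l) (PiYdd C) τ (rootTop C) + ε := by
  obtain ⟨τ, ε, hε, e⟩ := h
  -- apply `ρ^⊤_{α⁻¹}` to `e`
  have e' : rootTop C = h1TopConjEquiv (phi C) (D.lDeltaTheta l) (PiYdd C) (α.symm τ)
      (autActTopOfCor218i C hq μ hC hS h15 L R hR h218i α.symm (rootTop C)) +
      autActTopOfCor218i C hq μ hC hS h15 L R hR h218i α.symm ε := by
    have := congrArg (autActTopOfCor218i C hq μ hC hS h15 L R hR h218i α.symm) e
    rwa [← autActTopOfCor218i_symm_apply C hq μ hC hS h15 L R hR h218i α, AddEquiv.symm_apply_apply, map_add,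
      autActTopOfCor218i_h1TopConjEquiv] at this
  refine ⟨(α.symm τ)⁻¹, -(h1TopConjEquiv (phi C) (D.lDeltaTheta l) (PiYdd C) (α.symm τ)⁻¹
    (autActTopOfCor218i C hq μ hC hS h15 L R hR h218i α.symm ε)), ?_, ?_⟩
  · rw [smul_neg, ← map_nsmul, ← map_nsmul, hε, map_zero, map_zero, neg_zero]
  · have key := congrArg (h1TopConjEquiv (phi C) (D.lDeltaTheta l) (PiYdd C) (α.symm τ)⁻¹) e'
    rw [map_add, ← h1TopConjEquiv_mul_apply, inv_mul_cancel, h1TopConjEquiv_one_apply] at key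
    rw [← sub_eq_add_neg, eq_sub_iff_add_eq]
    exact key.symm

/- SUMMARY: with `rootHyp_of_inner`, `rootHyp_refl`, `rootHyp_trans`, `rootHyp_symm` the automorphisms satisfying
   `hroot` form a subgroup of `Aut_top(Π^tp_X̲̲)` containing every inner automorphism — (P4) descends to OUTER classes. -/

end RootHypSubgroup

end EtaleThetaDataOfSetting

end Literature.IUT.HodgeArakelov

end
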